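import Mathlib.Analysis.InnerProductSpace.Adjoint
import Mathlib.LinearAlgebra.Trace
import Mathlib.LinearAlgebra.Matrix.ToLinearEquiv
import Mathlib.LinearAlgebra.Complex.FiniteDimensional
import Literature.Geometry.Kaehler.HermitianHolomorphicBundle
import HarnessLib

/-!
# Hermitian holomorphic vector bundles II: mean curvature, the Einstein condition, norms

Sequel to `HermitianHolomorphicBundle.lean` (the Hermitian structure `h`, its matrix `H` in a
holomorphic frame, the Chern connection `θ = H⁻¹ d′H` and its curvature `Ω = (dθ)^{1,1}`). Given
in addition a Riemannian metric `g` on the real tangent bundle of the complex manifold `M`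
(Hermitian / Kähler in the sense of `Kaehler.lean`, Kähler form `ω(v, w) = g(Jv, w)`), this file
defines, following Kobayashi (1987), Ch. III §1 and Ch. IV §1 [Kobayashi1987]:

* `metricTrace g x b`: the trace `tr_g b = Σₖ b(fₖ, fₖ)` (`(fₖ)` any `g_x`-orthonormal basis of
  `T_x M`) of a vector-valued bilinear map, computed WITHOUT choosing an orthonormal frame as the
  inverse-Gram-matrix contraction `Σᵢⱼ (G⁻¹)ᵢⱼ b(vᵢ, vⱼ)` in the basis `finBasis ℝ E`
  (`metricTrace_inner`: `tr_g g = dim_ℝ M`);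
* `MForm.contractKaehler g β = Λβ`, the contraction of a vector-valued `2`-form with the Kähler
  form (pointwise adjoint of `L = ω ∧ ·`, Voisin I §6.1.1): `Λβ = ½ tr_g β(·, J·)`, with the
  normalisation THEOREM `contractKaehler_kaehlerForm`: `Λω = dim_ℂ M` for Hermitian `g`;
* Kobayashi's **mean curvature** `K = iΛΩ`, `Kⁱⱼ = Σ g^{αβ̄} Rⁱ_{jαβ̄}` (III.(1.6), IV.(1.1)–(1.2)):
  `h.meanCurvature g x₀ = (i/2) Λ Ω = (i/4) tr_g Ω(·, J·)` in the holomorphic frame at `x₀`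
  (normalisation checked on `ℂ` in its docstring);
* the **weak Einstein condition** `K = φ I` and the **Einstein condition** (`φ = c` constant;
  "Einstein–Hermitian", elsewhere Hermitian–Einstein / Hermitian–Yang–Mills), IV.§1:
  `h.IsWeakHermitianEinstein g φ`, `h.IsHermitianEinstein g c`;
* the `h`-adjoint `A^{*h} = H⁻¹ A† H` of an endomorphism in a frame, the squared `h`-norm
  `|A|²_h = tr(A A^{*h})`, and the pointwise squared norms `|K|²_h` (`meanCurvatureNormSq`) and
  `|Ω|²_{h,g} = Σ_{j<k} |Ω(fⱼ, fₖ)|²_h` (`curvatureNormSq`) — the quantities in Simpson's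
  hypotheses `sup |ΛF| < ∞`, `F ∈ L²` (Simpson (1988), §3) — as global functions `M → ℝ`
  (computed in the frame at the point itself);
* sanity: the flat product structure has `K = 0` and is Einstein–Hermitian with constant `0`.

## What is NOT here

Frame-independence of `K` (it transforms by conjugation); `deg`, slopes, stability and the
Kobayashi–Hitchin correspondence; integration of the norms (no Riemannian measure is chosen).

## References

* S. Kobayashi, *Differential Geometry of Complex Vector Bundles*, Princeton UP (1987), I.(7.17),
  III.§1 (1.6)–(1.7), III.(2.14)–(2.17), IV.§1 (1.1)–(1.3) [Kobayashi1987].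
* C. Voisin, *Hodge Theory and Complex Algebraic Geometry I* (2002), §6.1.1 (`L`, `Λ`)
  [VoisinHodgeI2002].
* C. T. Simpson, *Constructing variations of Hodge structure using Yang–Mills theory and
  applications to uniformization*, JAMS 1 (1988), §3, Thm. 1, Props. 3.4–3.5 [Simpson1988].
-/

noncomputable section

open scoped Manifold ContDiff Topology ComplexConjugate InnerProductSpace
open Bundle Set Module

namespace Literature.Geometry.Kaehler

/-! ### Traces over the tangent space against a Riemannian metric; the contraction `Λ` -/

section MetricTrace

variable {E : Type*} [NormedAddCommGroup E] [NormedSpace ℂ E] [FiniteDimensional ℂ E]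
  {M : Type*} [TopologicalSpace M] [ChartedSpace E M]
  {W : Type*} [NormedAddCommGroup W] [NormedSpace ℝ W]

/-- The **trace of a `W`-valued bilinear map `b` on `T_x M` with respect to the metric `g_x`**:
`tr_g b = Σₖ b(fₖ, fₖ)` for any `g_x`-orthonormal basis `(fₖ)`, computed without choosing one as
the inverse-Gram-matrix contraction `Σᵢⱼ (G⁻¹)ᵢⱼ b(vᵢ, vⱼ)`, `Gᵢⱼ = g_x(vᵢ, vⱼ)`, in the basis
`v = Module.finBasis ℝ E` of `T_x M = E` (the two agree: `v = A f`, `G = A ᵗA`,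
`ᵗA G⁻¹ A = 1`). Kobayashi's contractions `Σ g^{αβ̄}(…)_{αβ̄}` (III.(1.6)) are such traces.
[folklore] -/
def metricTrace (g : RiemannianMetric fun x : M ↦ TangentSpace 𝓘(ℝ, E) x) (x : M)
    (b : TangentSpace 𝓘(ℝ, E) x → TangentSpace 𝓘(ℝ, E) x → W) : W :=
  ∑ i, ∑ j, (Matrix.of fun i j ↦ g.inner x (finBasis ℝ E i) (finBasis ℝ E j))⁻¹ i j •
    b (finBasis ℝ E i) (finBasis ℝ E j)

/-- The trace of the zero map is zero. [folklore] -/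
@[simp]
theorem metricTrace_zero (g : RiemannianMetric fun x : M ↦ TangentSpace 𝓘(ℝ, E) x) (x : M) :
    metricTrace g x (fun _ _ ↦ (0 : W)) = 0 := by
  simp [metricTrace]

/-- The Gram matrix `(g_x(vᵢ, vⱼ))` of the metric in the basis `finBasis ℝ E` is invertible
(a vector `c` in its kernel gives `g_x(w, w) = ᵗc G c = 0` for `w = Σ cᵢ vᵢ`, so `w = 0`,
`c = 0`). [folklore] -/
theorem det_gram_ne_zero (g : RiemannianMetric fun x : M ↦ TangentSpace 𝓘(ℝ, E) x) (x : M) :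
    (Matrix.of fun i j ↦ g.inner x (finBasis ℝ E i) (finBasis ℝ E j)).det ≠ 0 := by
  intro hdet
  obtain ⟨v, hv, hGv⟩ := Matrix.exists_mulVec_eq_zero_iff.2 hdet
  set e : Fin (finrank ℝ E) → TangentSpace 𝓘(ℝ, E) x := fun i ↦ finBasis ℝ E i with he
  set w : TangentSpace 𝓘(ℝ, E) x := ∑ i, v i • e i with hw
  have hw0 : w ≠ 0 := fun h ↦
    hv (funext (Fintype.linearIndependent_iff.1 (finBasis ℝ E).linearIndependent v h))
  have hlin : ∀ u : TangentSpace 𝓘(ℝ, E) x, g.inner x u w = ∑ j, v j * g.inner x u (e j) := by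
    intro u
    rw [hw, map_sum]
    exact Finset.sum_congr rfl fun j _ ↦ by rw [map_smul, smul_eq_mul]
  have hlin' : ∀ u : TangentSpace 𝓘(ℝ, E) x, g.inner x w u = ∑ i, v i * g.inner x (e i) u := by
    intro u
    rw [g.symm x, hlin]
    exact Finset.sum_congr rfl fun i _ ↦ by rw [g.symm x]
  have key : g.inner x w w =
      dotProduct v ((Matrix.of fun i j ↦ g.inner x (finBasis ℝ E i) (finBasis ℝ E j)).mulVec v) := by
    rw [hlin' w]
    simp only [hlin, dotProduct, Matrix.mulVec, Matrix.of_apply, Finset.mul_sum, he]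
    exact Finset.sum_congr rfl fun i _ ↦ Finset.sum_congr rfl fun j _ ↦ by ring
  exact (g.pos x w hw0).ne' (by rw [key, hGv, dotProduct_zero])

/-- `tr_g g = dim_ℝ T_x M`: the inverse-Gram-matrix formula does compute traces
(`Σᵢⱼ (G⁻¹)ᵢⱼ Gᵢⱼ = tr(G⁻¹G) = tr 1`). [folklore] -/
theorem metricTrace_inner (g : RiemannianMetric fun x : M ↦ TangentSpace 𝓘(ℝ, E) x) (x : M) :
    metricTrace g x (fun v w ↦ g.inner x v w) = (finrank ℝ E : ℝ) := by
  set G : Matrix _ _ ℝ := Matrix.of fun i j ↦ g.inner x (finBasis ℝ E i) (finBasis ℝ E j)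
    with hG
  have h1 : G⁻¹ * G = 1 :=
    Matrix.nonsing_inv_mul G (isUnit_iff_ne_zero.2 (det_gram_ne_zero g x))
  calc metricTrace g x (fun v w ↦ g.inner x v w) = ∑ i, (G⁻¹ * G) i i := by
        simp only [metricTrace, Matrix.mul_apply, smul_eq_mul]
        exact Finset.sum_congr rfl fun i _ ↦ Finset.sum_congr rfl fun j _ ↦ by
          rw [hG, Matrix.of_apply, g.symm x]
    _ = (finrank ℝ E : ℝ) := by simp [h1]

/-- The **contraction `Λ` of a `W`-valued `2`-form with the Kähler form** `ω(v, w) = g(Jv, w)` of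
a Hermitian metric `g` (`Bundle.RiemannianMetric.kaehlerForm`), pointwise the adjoint of
`L = ω ∧ ·` for the metric on forms induced by `g` (Voisin I, §6.1.1):
`(Λβ)(x) = ½ tr_g β_x(·, J·) = Σ_{j<k} ω^{jk} β_{jk}`; for a `g_x`-unitary basis `(e_α, Je_α)`,
`Λβ = Σ_α β(e_α, Je_α)`, so `Λω = dim_ℂ M` (`contractKaehler_kaehlerForm`). (Kobayashi's `Λ`,
III.(2.14), is built on `Φ = 2ω`, I.(7.17); only `K = iΛΩ`, spelled out in `meanCurvature`, is
taken from him.) [cite: VoisinHodgeI2002, §6.1.1] -/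
def MForm.contractKaehler (g : RiemannianMetric fun x : M ↦ TangentSpace 𝓘(ℝ, E) x)
    (β : MForm 𝓘(ℝ, E) M W 2) : M → W := fun x ↦
  (2⁻¹ : ℝ) • metricTrace g x fun v w ↦ β x ![v, tangentJ E x w]

/-- `Λ 0 = 0`. [folklore] -/
@[simp]
theorem MForm.contractKaehler_zero (g : RiemannianMetric fun x : M ↦ TangentSpace 𝓘(ℝ, E) x) :
    (0 : MForm 𝓘(ℝ, E) M W 2).contractKaehler g = 0 := by
  funext x; simp [MForm.contractKaehler]

/-- **Normalisation of `Λ`**: for a Hermitian metric `g`, `Λω = dim_ℂ M` pointwise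
(`ω(v, Jw) = g(Jv, Jw) = g(v, w)`, so `Λω = ½ tr_g g = ½ dim_ℝ M`). Voisin I, §6.1.1
(`[L, Λ] = (k - n) Id` on `k`-forms gives `ΛL1 = n`). [cite: VoisinHodgeI2002, §6.1.1] -/
theorem contractKaehler_kaehlerForm (g : RiemannianMetric fun x : M ↦ TangentSpace 𝓘(ℝ, E) x)
    (hg : g.IsHermitian) (x : M) :
    g.kaehlerForm.contractKaehler g x = (finrank ℂ E : ℝ) := by
  have h : (fun v w ↦ g.kaehlerForm x ![v, tangentJ E x w]) = fun v w ↦ g.inner x v w := by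
    funext v w
    rw [RiemannianMetric.kaehlerForm_apply_of_isHermitian g hg, hg]
  simp only [MForm.contractKaehler, h, metricTrace_inner, finrank_real_of_complex, Nat.cast_mul,
    Nat.cast_ofNat, smul_eq_mul]
  ring

end MetricTrace

namespace HermitianHolomorphicBundle

variable {E : Type*} [NormedAddCommGroup E] [NormedSpace ℂ E] [FiniteDimensional ℂ E]
  {M : Type*} [TopologicalSpace M] [ChartedSpace E M]
  {F : Type*} [NormedAddCommGroup F] [InnerProductSpace ℂ F] [FiniteDimensional ℂ F]
  {V : M → Type*} [TopologicalSpace (TotalSpace F V)] [∀ x, TopologicalSpace (V x)]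
  [∀ x, AddCommGroup (V x)] [∀ x, Module ℂ (V x)] [FiberBundle F V] [VectorBundle ℂ F V]
  [IsManifold 𝓘(ℂ, E) ω M] [ContMDiffVectorBundle ω F V 𝓘(ℂ, E)]

/-! ### Mean curvature and the Einstein condition -/

/-- Kobayashi's **mean curvature** `K` of `(V, h)` with respect to a Hermitian metric `g` on `M`,
in the holomorphic frame at `x₀`: the `End F`-valued function `K = iΛΩ`,
`Kⁱⱼ = Σ g^{αβ̄} Rⁱ_{jαβ̄}` where `Ωⁱⱼ = Σ Rⁱ_{jαβ̄} dz^α ∧ dz̄^β` and `g = Σ g_{αβ̄} dz^α dz̄^β`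
(III.(1.6)–(1.7), IV.(1.1)–(1.2)). In real terms `K = (i/2) Λ Ω = (i/4) tr_g Ω(·, J·)`, `g` the
real (Riemannian) metric with `g_{αβ̄}` its Hermitian extension: on `ℂ` with `Ω = R dz ∧ dz̄`
and `g = |dz|²` (`f₁ = 1`, `f₂ = i` orthonormal), `Σₖ Ω(fₖ, Jfₖ) = 2Ω(1, i) = -4iR`, so
`K = (i/4)(-4iR) = R = g^{11̄}R_{11̄}`. [cite: Kobayashi1987, IV.(1.1)–(1.2)] -/
def meanCurvature (h : HermitianHolomorphicBundle E F V)
    (g : RiemannianMetric fun x : M ↦ TangentSpace 𝓘(ℝ, E) x) (x₀ : M) : M → (F →L[ℂ] F) :=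
  fun x ↦ (Complex.I / 2) • (h.curvatureForm x₀).contractKaehler g x

/-- The **weak Einstein condition** with factor `φ : M → ℝ` for `(V, h)` over `(M, g)`:
`K = φ I_V`, i.e. `Kⁱⱼ = φ δⁱⱼ` in every holomorphic frame of the atlas, on its domain
(Kobayashi IV.§1, after (1.3)). [cite: Kobayashi1987, IV.§1 (p. 99)] -/
def IsWeakHermitianEinstein (h : HermitianHolomorphicBundle E F V)
    (g : RiemannianMetric fun x : M ↦ TangentSpace 𝓘(ℝ, E) x) (φ : M → ℝ) : Prop :=
  ∀ x₀, ∀ x ∈ (trivializationAt F V x₀).baseSet,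
    h.meanCurvature g x₀ x = ((φ x : ℝ) : ℂ) • ContinuousLinearMap.id ℂ F

/-- The **Einstein condition** with constant factor `c`: `K = c I_V`; `(V, h)` is then an
*Einstein–Hermitian* vector bundle over `(M, g)` (Kobayashi IV.§1) — elsewhere Hermitian–Einstein,
or Hermitian–Yang–Mills (Simpson (1988), §3: `ΛF_H^⊥ = 0`). [cite: Kobayashi1987, IV.§1 (p. 99)] -/
def IsHermitianEinstein (h : HermitianHolomorphicBundle E F V)
    (g : RiemannianMetric fun x : M ↦ TangentSpace 𝓘(ℝ, E) x) (c : ℝ) : Prop :=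
  h.IsWeakHermitianEinstein g fun _ ↦ c

/-! ### Pointwise `h`-norms of endomorphisms, of `K` and of `Ω` -/

/-- The **`h`-adjoint** of an endomorphism written in the holomorphic frame at `x₀`:
`A^{*h} = H⁻¹ A† H` (`A†` the adjoint for the reference inner product of `F`), characterised by
`h(A u, v) = h(u, A^{*h} v)`. [folklore] -/
def frameAdjoint (h : HermitianHolomorphicBundle E F V) (x₀ x : M) (A : F →L[ℂ] F) : F →L[ℂ] F :=
  (h.frameOp x₀ x).inverse.comp
    ((LinearMap.toContinuousLinearMap (LinearMap.adjoint (A : F →ₗ[ℂ] F))).comp (h.frameOp x₀ x))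

/-- The **squared `h`-norm of an endomorphism** in the frame at `x₀`:
`|A|²_h = tr (A ∘ A^{*h})` (`= Σ |a_{ij}|²` in an `h`-unitary frame). [folklore] -/
def endNormSq (h : HermitianHolomorphicBundle E F V) (x₀ x : M) (A : F →L[ℂ] F) : ℝ :=
  (LinearMap.trace ℂ F ((A.comp (h.frameAdjoint x₀ x A) : F →L[ℂ] F) : F →ₗ[ℂ] F)).re

/-- The pointwise **squared norm of the mean curvature**, `x ↦ |K(x)|²_h`, computed in the
holomorphic frame at the point itself (a scalar, independent of the frame). Simpson's
hypothesis `sup |ΛF_K| < ∞` (1988, §3, Thm. 1) is boundedness of this function.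
[cite: Simpson1988, §3 Thm. 1] -/
def meanCurvatureNormSq (h : HermitianHolomorphicBundle E F V)
    (g : RiemannianMetric fun x : M ↦ TangentSpace 𝓘(ℝ, E) x) : M → ℝ := fun x ↦
  h.endNormSq x x (h.meanCurvature g x x)

/-- The pointwise **squared norm of the curvature**, `x ↦ |Ω(x)|²_{h,g} = Σ_{j<k} |Ω(fⱼ, fₖ)|²_h`
for a `g_x`-orthonormal basis `(fⱼ)` of `T_x M`, i.e. `½ Σ G^{ik} G^{jl} re tr(Ω_{ij} Ω_{kl}^{*h})`
in the basis `finBasis ℝ E` (`G` its Gram matrix), in the frame at the point itself; the energy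
density of the Yang–Mills functional `∫ |Ω|² dvol_g` (curvature in `L²`: Simpson (1988), §3,
Props. 3.4–3.5). [cite: Simpson1988, §3 Prop. 3.5] -/
def curvatureNormSq (h : HermitianHolomorphicBundle E F V)
    (g : RiemannianMetric fun x : M ↦ TangentSpace 𝓘(ℝ, E) x) : M → ℝ := fun x ↦
  letI G := (Matrix.of fun i j ↦ g.inner x (finBasis ℝ E i) (finBasis ℝ E j))⁻¹
  letI Ω := fun i j ↦ h.curvatureForm x x ![finBasis ℝ E i, finBasis ℝ E j]
  2⁻¹ * ∑ i, ∑ j, ∑ k, ∑ l, G i k * G j l *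
    (LinearMap.trace ℂ F (((Ω i j).comp (h.frameAdjoint x x (Ω k l)) : F →L[ℂ] F) : F →ₗ[ℂ] F)).re

/-! ### The flat product bundle -/

/-- The mean curvature of the flat product structure vanishes, for every `g`. [folklore] -/
theorem trivial_meanCurvature (g : RiemannianMetric fun x : M ↦ TangentSpace 𝓘(ℝ, E) x) (x₀ : M) :
    (trivial E M F).meanCurvature g x₀ = 0 := by
  funext x
  simp [meanCurvature, trivial_curvatureForm]

/-- The flat product structure is Einstein–Hermitian with constant `0`, for every `g`
(Kobayashi IV.§1). [cite: Kobayashi1987, IV.§1 (p. 99)] -/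
theorem trivial_isHermitianEinstein (g : RiemannianMetric fun x : M ↦ TangentSpace 𝓘(ℝ, E) x) :
    (trivial E M F).IsHermitianEinstein g 0 := fun x₀ x _ ↦ by
  simp [trivial_meanCurvature]

/-- The mean curvature of the flat product structure has norm `0`. [folklore] -/
theorem trivial_meanCurvatureNormSq (g : RiemannianMetric fun x : M ↦ TangentSpace 𝓘(ℝ, E) x) :
    (trivial E M F).meanCurvatureNormSq g = 0 := by
  funext x
  simp [meanCurvatureNormSq, trivial_meanCurvature, endNormSq]

/-- The curvature of the flat product structure has norm `0`. [folklore] -/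
theorem trivial_curvatureNormSq (g : RiemannianMetric fun x : M ↦ TangentSpace 𝓘(ℝ, E) x) :
    (trivial E M F).curvatureNormSq g = 0 := by
  funext x
  simp [curvatureNormSq, trivial_curvatureForm]

end HermitianHolomorphicBundle

end Literature.Geometry.Kaehler
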